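import Literature.NumberTheory.Rogawski1990.CurveThetaHodgeTypeNecessity   -- ED. 2: the ORIENTED letters #74R `…_hol_pos` ∕ `…_antihol_pos`
import Summits.HodgeConjecture.HodgeConjecture.Theorems.HLiu418E3AntiholOfHol
import Summits.HodgeConjecture.HodgeConjecture.Theorems.HLiu418ChiSplittingMirror
import HarnessLib

/-!
# Crux `HLiu418`, floor 0, programme P5 — the ORIENTED necessity letters E3nec₂ (#74R, EDITION 2 of ★ `Rogawski1990/CurveThetaHodgeTypeNecessity`, ★ p848618):
# the antiholomorphic one FOLLOWS from the holomorphic one (PORT-2 of ★ `Theorems/HLiu418E3Necessity` onto the re-lettered #74R)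

Cell hodgecm-mathlib (D-0151), crux item `HLiu418` = stmt-HodgeConjecture-24832, parent line `Cruxes/HLiu418/Lines/F0_AlbCm.lean` (packaged stub
`stub_S1b_facts`); seat LA1-p03 (g2) on LD2-plan (g0)'s port list (2026-09-02, LEAD ruling «LD-R1»: letter #74 `curveThetaHodgeTypeNecessity_hol` is MISSTATED —
it omits the orientation binders `(hτt : 0 < (ι t).re) (hτt' : (ι t).im = 0)` of the consumer `S1BettiShape` — and is RE-LETTERED as #74R
`curveThetaHodgeTypeNecessity_hol_pos` ∕ `…_antihol_pos`).  THEOREMS ONLY (no definition, no instance, no notation, no named fact, no `sorry`);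
`--supports stmt-HodgeConjecture-24832`, count-neutral.  HC_CM is proved only modulo the 7 printed citations (+ declared floor-0 debt) until rung 0 closes; nothing
printed is discharged here.  = ★ `Theorems/HLiu418E3Necessity.lean` (F0P5-p02 (g4)) VERBATIM except: the hypothesis ∕ conclusion types are the `_pos` letters and the
two orientation binders `hτt hτt'` are introduced and PASSED UNCHANGED to the holomorphic letter (the conjugation road does not touch `(H, t)`); ★ original stays as
settled content.

* **`curveThetaHodgeTypeNecessity_antihol_pos_of_hol_pos : _hol_pos → _antihol_pos`** — p04 (g3)'s conjugation road ★ `E3AntiholOfHol` restricted to one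
  direction: `P ↦ P̄` exchanges the Hodge types (★ `isAntiholCotangentAt₂_iff_conj`), `σ ↦ σ̄ = repConj σ` (★ `hasFinComponent_conj_repConj`), the theta carrier goes
  to its conjugate partner `ω(λᶜ, ⟨−a⟩, χ̄)` with `Φ_{λᶜ} = Φ̄_λ` (★ `DoubledWeilMirror.exists_conjPartner_omegaAtLine_neg`, [Liu2021, Lem. D.1 (2)]), admissibility
  flips `adm(λ, a) ↔ adm(λᶜ, −a)` (★ `E3AntiholOfHol.exists_isAdmissibleElement_bar_locF_neg_iff`, [Liu2021, Def. 4.12, last sentence]); the holomorphic necessity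
  at the conjugate data — SAME `(H, t)`, hence same orientation — gives `e♮ ∈ Φ̄_λ`, i.e. `e♮ ∉ Φ_λ`.
⇒ in the parent's books ONE letter `curveThetaHodgeTypeNecessity_hol_pos` (#74R) serves every E3 slot.

References: [Liu2021] Y. Liu, Camb. J. Math. 9 (2021), App. D Rem. D.5 (p. 131), Lem. D.1 (2), Def. 4.12, Rem. 4.4.  [HarrisKudlaSweet1996] J. AMS 9 (1996),
Thm. 6.1.  [Kudla1994] Israel J. Math. 87, §3 Thm. 3.1.  [Li1992] J. reine angew. Math. 428 (1992), p. 181.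
-/

set_option autoImplicit false
-- the mandated namespace has the single-problem summit's repeated segment (`HodgeConjecture.HodgeConjecture`)
set_option linter.dupNamespace false

noncomputable section

open NumberField NumberField.InfinitePlace MeasureTheory IsDedekindDomain
open scoped Matrix ComplexOrder
open Literature.NumberTheory.Automorphic Literature.NumberTheory.Automorphic.UnitaryGroup
open Literature.NumberTheory.Automorphic.UnitaryGroup.CotangentForms (toQuotFun hasFinComponent_conj_repConj)
open Literature.NumberTheory.Automorphic.UnitaryCurveForms
open Literature.NumberTheory.Automorphic.ConjVec
open Literature.NumberTheory.Automorphic.Liu2021 Literature.NumberTheory.Automorphic.Liu2021.Def411WeilCarriers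
open Literature.NumberTheory.Automorphic.Liu2021.Def411WeilCarriersDoubling
open Literature.NumberTheory.GaloisRepresentations Literature.NumberTheory.Automorphic.IdeleClassGroup
open Literature.AlgebraicGeometry.Liu2021 (IsAdmissibleElement)
open Literature.NumberTheory.GelbartRogawski1991 Literature.NumberTheory.GelbartRogawski1991.UnitaryDualPair
open Literature.RepresentationTheory.Liu2021 Literature.RepresentationTheory.HarrisKudlaSweet1996
open Literature.NumberTheory.ComplexMultiplication (CMTypeOps.bar CMTypeOps.mem_bar_iff)
open Literature.NumberTheory.Rogawski1990 (curveThetaHodgeTypeNecessity_hol_pos curveThetaHodgeTypeNecessity_antihol_pos)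
open Summit.HodgeConjecture.HodgeConjecture.Cruxes.HLiu418.DoubledWeilMirror (exists_conjPartner_omegaAtLine_neg)
open Summit.HodgeConjecture.HodgeConjecture.Cruxes.HLiu418.E3AntiholOfHol (exists_isAdmissibleElement_bar_locF_neg_iff)

namespace Summit.HodgeConjecture.HodgeConjecture.Cruxes.HLiu418.E3NecessityPos

/-! ## The oriented antiholomorphic necessity follows from the oriented holomorphic one -/

set_option maxHeartbeats 4000000 in
-- (two instances of the E3nec letter telescope and the conjugate-partner telescope are elaborated and matched; as in ★ `E3AntiholOfHol` ∕ ★ `E3Necessity`)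
/-- **E3nec-antihol₂-pos ⟸ E3nec-hol₂-pos (#74R), UNCONDITIONALLY.**  Given antiholomorphic data `(λ, a, χ, W, σ, j, P)` for `H = t⁻¹·g*(diag dV)g` with
`0 < (ι t).re`, `(ι t).im = 0` and `ε_a` λ-admissible: `P̄` is holomorphic (★ `isAntiholCotangentAt₂_iff_conj`) with finite component `σ̄ = repConj σ`
(★ `hasFinComponent_conj_repConj`), irreducible and smooth; the conjugate partner `J : ω(λ, ⟨a⟩, χ) → ω(λᶜ, ⟨−a⟩, χ̄)` (★ `exists_conjPartner_omegaAtLine_neg`,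
`Φ_{λᶜ} = Φ̄_λ`) gives the complex-linear injective intertwiner `J ∘ j ∘ toConj⁻¹`; `ε_{−a}` is λᶜ-admissible (★ `exists_isAdmissibleElement_bar_locF_neg_iff`); the
oriented holomorphic necessity there (same `H`, `t`, `g`, hence the binders `hτt hτt'` pass unchanged) gives `e♮ ∈ Φ̄_λ`, i.e. `e♮ ∉ Φ_λ` (`CMTypeOps.mem_bar_iff`).
Port of ★ `E3Necessity.curveThetaHodgeTypeNecessity_antihol_of_hol` onto the re-lettered #74R.
[cite: Liu2021, App. D Rem. D.5 (p. 131); Lem. D.1 (2) (l. 5231); Def. 4.12; Rem. 4.4] [cite: Kudla1994, §3 Thm. 3.1] [cite: Li1992, p. 181] -/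
theorem curveThetaHodgeTypeNecessity_antihol_pos_of_hol_pos (hN : curveThetaHodgeTypeNecessity_hol_pos) :
    curveThetaHodgeTypeNecessity_antihol_pos := by
  intro L _ _ _ ι H dV hdV hdV0 t ht hτt hτt' g hg hsig hpos h4 𝔣 μ _ n' e₁ lam hlam hw a χ W _ _ σ hirr hsm j hj P hP hPσ hadm
  -- the conjugate partner at `(λ, a, χ)`
  obtain ⟨lam', hlam', hw', hΦ', J, hJb, hJ⟩ := exists_conjPartner_omegaAtLine_neg L e₁ dV hdV hdV0 lam hlam hw a χ
  -- the conjugate data: `P̄` holomorphic with finite component `σ̄`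
  have hP' : P.conj.IsHolCotangentAt₂ (IsCMField.complexConj_ne_one L) (UnitaryGroup.complexConj_smul_infinitePlace L)
      (cmPlace L ι) 𝔣 := (isAntiholCotangentAt₂_iff_conj _ _ _ P 𝔣).mp hP
  have hPσ' : P.conj.HasFinComponent (repConj σ) := hasFinComponent_conj_repConj P hPσ
  have hirr' : (repConj σ).IsIrreducible := (isIrreducible_repConj_iff σ).mpr hirr
  have hsm' : (repConj σ).IsSmooth := (isSmooth_repConj_iff σ).mpr hsm
  -- the conjugate intertwiner `J ∘ j ∘ toConj⁻¹`, complex-linear and injective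
  let j'ₗ := (J : _ →ₛₗ[starRingEnd ℂ] _).comp (j.toLinearMap.comp ((toConj (V := W)).symm : ConjVec W →ₛₗ[starRingEnd ℂ] W))
  have hj'ₗ : ∀ w : ConjVec W, j'ₗ w = J (j ((toConj (V := W)).symm w)) := fun _ => rfl
  let j' := LinearMap.intertwiningMap_of_isIntertwiningMap (repConj σ)
    ((rhoVAtLine (↥(maximalRealSubfield L)) L (IsCMField.complexConj L) 2 e₁ (Matrix.diagonal dV)
        (complexConj_imagUnit L) (imagUnit_ne_zero L) (imagUnit_mul_self L) (realDiagonal_isSymm L dV hdV)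
        (isUnit_det_realDiagonal L dV hdV hdV0) (realDiagonal_map L dV hdV).symm
        (fun a => isCompatible_chiSplittingLine L e₁ dV hdV hdV0 (toHeckeCharacter L lam')
          (isUnitary_toHeckeCharacter L lam') ((isOscillatorChar_toHeckeCharacter_iff lam').mpr hlam')
          (TW (↥(maximalRealSubfield L)) a) (isSymm_TW (↥(maximalRealSubfield L)) a)
          (isUnit_det_TW (↥(maximalRealSubfield L)) a) (JW (↥(maximalRealSubfield L)) L a)
          (JW_eq (↥(maximalRealSubfield L)) L a)) (-a)
        ⟨(Units.map ((starRingEnd ℂ : ℂ →+* ℂ) : ℂ →* ℂ)).comp χ.1,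
          isAutomorphicOneChar_unitsMap_comp_chi (IsCMField.complexConj L) χ _⟩).comp
      (finAdelicCongr (↥(maximalRealSubfield L)) L (IsCMField.complexConj L) g ht hg).symm.toMonoidHom)
    j'ₗ (fun k w => by
      rw [hj'ₗ, hj'ₗ, repConj_apply, LinearEquiv.symm_apply_apply,
        Representation.IntertwiningMap.isIntertwining σ _ j k, MonoidHom.comp_apply, MonoidHom.comp_apply]
      exact hJ _ _)
  have hj'app : ∀ w : ConjVec W, j' w = J (j ((toConj (V := W)).symm w)) := fun _ => rfl
  have hj' : Function.Injective j' := fun w w' hww' => by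
    rw [hj'app, hj'app] at hww'
    exact (toConj (V := W)).symm.injective (hj (hJb.1 hww'))
  -- admissibility of `ε_{−a}` for `λᶜ` (`Φ_{λᶜ} = Φ̄_λ`)
  have hadm' : ∃ e : L, IsAdmissibleElement L hlam'.cmType.1 e ∧
      epsOf (↥(maximalRealSubfield L)) (imagUnitSq L) L (2 * imagUnit L)⁻¹ e = locF (↥(maximalRealSubfield L)) (imagUnitSq L) (-a) := by
    rw [hΦ']
    exact (exists_isAdmissibleElement_bar_locF_neg_iff hlam.cmType a).mpr hadm
  -- the holomorphic necessity at the conjugate data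
  have key := hN L ι H dV hdV hdV0 t ht hτt hτt' g hg hsig hpos h4 𝔣 μ e₁ lam' hlam' hw' (-a)
    ⟨(Units.map ((starRingEnd ℂ : ℂ →+* ℂ) : ℂ →* ℂ)).comp χ.1,
      isAutomorphicOneChar_unitsMap_comp_chi (IsCMField.complexConj L) χ _⟩
    (ConjVec W) (repConj σ) hirr' hsm' j' hj' P.conj hP' hPσ' hadm'
  rw [hΦ', CMTypeOps.mem_bar_iff] at key
  exact key

/-- The same as a bare implication between the two named facts, for by-name consumption. [cite: Liu2021, App. D Rem. D.5 (p. 131)] -/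
theorem curveThetaHodgeTypeNecessity_hol_pos_imp_antihol_pos :
    curveThetaHodgeTypeNecessity_hol_pos → curveThetaHodgeTypeNecessity_antihol_pos :=
  curveThetaHodgeTypeNecessity_antihol_pos_of_hol_pos

end Summit.HodgeConjecture.HodgeConjecture.Cruxes.HLiu418.E3NecessityPos

end
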